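import Mathlib
import HarnessLib

/-!
# The entropy ledger (stub `stub_entropyLedger`, line `gossip-forecast-ledger`)

Helper file (`--supports stmt-AtomisticToContinuum-14662`) proving the registered stub
`stub_entropyLedger` (S2, "THE LEDGER") of the lead's skeleton for the crux
`Summit.AtomisticToContinuum.HydrodynamicLimit.Theses.OneFlightGossipEngine.KineticCurrentsWindowLDUniform`
(line `gossip-forecast-ledger`). The statement is pure probability (Mathlib only) and is spelled
exactly as registered.

**Statement.** For probability measures `Q ≪ P` with `KL(Q‖P) < ∞`, a filtration `ℱ` of `mΩ`, a
`P`- and `Q`-integrable `X` that is `P`-a.e. `⨆ n, ℱ n`-measurable, forecasts `f_n := P[X | ℱ n]`,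
increments `d_k := f_{k+1} − f_k`, and nonnegative adapted "quadratic budgets" `V_k` (a.e. summable)
with the one-step exponential supermartingale bound
`∫⁻_s exp(α d_k − α² V_k / 2) dP ≤ P s` for all `s ∈ ℱ k`, one has
`E_Q X − E_Q f_0 ≤ KL(Q‖P)/α + (α/2) E_Q Σ_k V_k` (`α > 0`).

**Proof.**
* (i) `EntropyLedger.lintegral_mul_le_of_setLIntegral_le`: the set inequality upgrades to
  `∫⁻ g ρ dP ≤ ∫⁻ g dP` for every `ℱ k`-measurable `g ≥ 0` (the trimmed measures satisfy
  `(ρ • P)|_{ℱ k} ≤ P|_{ℱ k}`; `lintegral_trim`, `lintegral_withDensity_eq_lintegral_mul`);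
  iterating (`EntropyLedger.lintegral_expMartingale_le_one`) gives `∫⁻ M_n dP ≤ 1` for
  `M_n := exp(α (f_n − f_0) − (α²/2) Σ_{k<n} V_k)`.
* (ii) Lévy's upward theorem (`MeasureTheory.tendsto_ae_condExp` together with
  `condExp_of_aestronglyMeasurable'`) gives `f_n → X` `P`-a.e., hence
  `M_n → M_∞ := exp(α (X − f_0) − (α²/2) Σ' V)` `P`-a.e., and Fatou (`lintegral_liminf_le`) gives
  `∫⁻ M_∞ dP ≤ 1`.
* (iii) Donsker–Varadhan / Gibbs (`EntropyLedger.integral_le_toReal_klDiv_of_lintegral_exp_le_one`,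
  via Mathlib's tilted measures: `0 ≤ KL(Q ‖ P.tilted g) = KL(Q‖P) − ∫ g dQ + log ∫ e^g dP`):
  `∫ log M_∞ dQ ≤ KL(Q‖P)`; expand the integral and divide by `α`.

Nothing here depends on the hard-sphere model; no named facts are used.
-/

noncomputable section

open MeasureTheory Set Filter InformationTheory
open scoped ENNReal Topology Classical ProbabilityTheory

namespace Summit.AtomisticToContinuum.HydrodynamicLimit.Theorems.KineticCurrentsWindowLDUniformGossip

namespace EntropyLedger

/-- **Donsker–Varadhan / Gibbs variational inequality (one-sided).** For probability measures
`Q ≪ P` with finite Kullback–Leibler divergence and a `Q`-integrable, `P`-a.e.-measurable `g` with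
`∫ e^g dP ≤ 1`, one has `∫ g dQ ≤ KL(Q‖P)`.
Proof: `0 ≤ KL(Q ‖ P.tilted g) = KL(Q‖P) − ∫ g dQ + log ∫ e^g dP` and `log ∫ e^g dP ≤ 0`. -/
theorem integral_le_toReal_klDiv_of_lintegral_exp_le_one {Ω : Type*} {mΩ : MeasurableSpace Ω}
    {P Q : Measure Ω} [IsProbabilityMeasure P] [IsProbabilityMeasure Q]
    (hQP : Q ≪ P) (hKL : klDiv Q P ≠ ∞) {g : Ω → ℝ} (hgm : AEMeasurable g P)
    (hgQ : Integrable g Q) (hexp : ∫⁻ ω, ENNReal.ofReal (Real.exp (g ω)) ∂P ≤ 1) :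
    ∫ ω, g ω ∂Q ≤ (klDiv Q P).toReal := by
  have hllr : Integrable (llr Q P) Q := (klDiv_ne_top_iff.mp hKL).2
  have hexpm : AEStronglyMeasurable (fun ω => Real.exp (g ω)) P :=
    (Real.measurable_exp.comp_aemeasurable hgm).aestronglyMeasurable
  have hexpP : Integrable (fun ω => Real.exp (g ω)) P :=
    (lintegral_ofReal_ne_top_iff_integrable hexpm
      (ae_of_all _ fun _ => (Real.exp_pos _).le)).mp
      (ne_top_of_le_ne_top ENNReal.one_ne_top hexp)
  have hZpos : 0 < ∫ ω, Real.exp (g ω) ∂P := integral_exp_pos hexpP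
  have hZle : ∫ ω, Real.exp (g ω) ∂P ≤ 1 := by
    rw [← ENNReal.ofReal_le_one, ofReal_integral_eq_lintegral_ofReal hexpP
      (ae_of_all _ fun _ => (Real.exp_pos _).le)]
    exact hexp
  have hlogZ : Real.log (∫ ω, Real.exp (g ω) ∂P) ≤ 0 := Real.log_nonpos hZpos.le hZle
  haveI : IsProbabilityMeasure (P.tilted g) := isProbabilityMeasure_tilted hexpP
  have hQt : Q ≪ P.tilted g := hQP.trans (absolutelyContinuous_tilted hexpP)
  have h1 : (klDiv Q (P.tilted g)).toReal = ∫ ω, llr Q (P.tilted g) ω ∂Q :=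
    toReal_klDiv_of_measure_eq hQt (by simp)
  have h2 : ∫ ω, llr Q (P.tilted g) ω ∂Q
      = ∫ ω, llr Q P ω ∂Q - ∫ ω, g ω ∂Q + Real.log (∫ ω, Real.exp (g ω) ∂P) :=
    integral_llr_tilted_right hQP hgQ hexpP hllr
  have h3 : (klDiv Q P).toReal = ∫ ω, llr Q P ω ∂Q := toReal_klDiv_of_measure_eq hQP (by simp)
  have h0 : 0 ≤ (klDiv Q (P.tilted g)).toReal := ENNReal.toReal_nonneg
  linarith

/-- **One supermartingale step.** If a density `ρ` satisfies `∫⁻_s ρ dP ≤ P s` for every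
`m`-measurable `s` (`m ≤ mΩ`), then `∫⁻ g ρ dP ≤ ∫⁻ g dP` for every `m`-measurable
`g : Ω → ℝ≥0∞` (the trimmed measures satisfy `(ρ • P)|ₘ ≤ P|ₘ`). -/
theorem lintegral_mul_le_of_setLIntegral_le {Ω : Type*} {m mΩ : MeasurableSpace Ω}
    {P : Measure Ω} (hm : m ≤ mΩ) {ρ : Ω → ℝ≥0∞} (hρ : Measurable ρ)
    (H : ∀ s, MeasurableSet[m] s → ∫⁻ ω in s, ρ ω ∂P ≤ P s)
    {g : Ω → ℝ≥0∞} (hg : Measurable[m] g) :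
    ∫⁻ ω, g ω * ρ ω ∂P ≤ ∫⁻ ω, g ω ∂P := by
  have hle : (P.withDensity ρ).trim hm ≤ P.trim hm := by
    refine Measure.le_iff.2 fun s hs => ?_
    rw [trim_measurableSet_eq hm hs, trim_measurableSet_eq hm hs,
      withDensity_apply ρ (hm s hs)]
    exact H s hs
  calc ∫⁻ ω, g ω * ρ ω ∂P = ∫⁻ ω, (ρ * g) ω ∂P := by
        refine lintegral_congr fun ω => ?_
        rw [Pi.mul_apply, mul_comm]
    _ = ∫⁻ ω, g ω ∂(P.withDensity ρ) :=
        (lintegral_withDensity_eq_lintegral_mul P hρ (hg.mono hm le_rfl)).symm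
    _ = ∫⁻ ω, g ω ∂((P.withDensity ρ).trim hm) := (lintegral_trim hm hg).symm
    _ ≤ ∫⁻ ω, g ω ∂(P.trim hm) := lintegral_mono' hle le_rfl
    _ = ∫⁻ ω, g ω ∂P := lintegral_trim hm hg

/-- Measurability (w.r.t. the ambient σ-algebra) of the one-step density
`ω ↦ ofReal (exp (α (a ω − b ω) − α² c ω / 2))`. -/
theorem measurable_stepDensity {Ω : Type*} {mΩ : MeasurableSpace Ω} {a b c : Ω → ℝ}
    (ha : Measurable a) (hb : Measurable b) (hc : Measurable c) (α : ℝ) :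
    Measurable fun ω => ENNReal.ofReal (Real.exp (α * (a ω - b ω) - α ^ 2 * c ω / 2)) :=
  ENNReal.measurable_ofReal.comp (Real.measurable_exp.comp
    (((ha.sub hb).const_mul α).sub ((hc.const_mul (α ^ 2)).div_const 2)))

/-- **Exponential supermartingale iteration.** For an adapted real sequence `f` and adapted `V`
with the one-step bound `∫⁻_s ofReal (exp (α (f (k+1) − f k) − α² V k / 2)) dP ≤ P s`
(`s ∈ ℱ k`), the process `M_n := exp (α (f n − f 0) − (α²/2) Σ_{k<n} V k)` satisfies
`∫⁻ M_n dP ≤ 1` for every `n` (induction on `n`, one `lintegral_mul_le_of_setLIntegral_le` step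
with the `ℱ n`-measurable weight `M_n`). -/
theorem lintegral_expMartingale_le_one {Ω : Type*} {mΩ : MeasurableSpace Ω} {P : Measure Ω}
    [IsProbabilityMeasure P] (ℱ : ℕ → MeasurableSpace Ω) (hmono : Monotone ℱ)
    (hle : ∀ n, ℱ n ≤ mΩ) (f V : ℕ → Ω → ℝ) (hf : ∀ n, Measurable[ℱ n] (f n))
    (hV : ∀ k, Measurable[ℱ k] (V k)) (α : ℝ)
    (H : ∀ (k : ℕ) (s : Set Ω), MeasurableSet[ℱ k] s →
      ∫⁻ ω in s, ENNReal.ofReal (Real.exp (α * (f (k + 1) ω - f k ω) - α ^ 2 * V k ω / 2)) ∂P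
        ≤ P s)
    (n : ℕ) :
    ∫⁻ ω, ENNReal.ofReal
        (Real.exp (α * (f n ω - f 0 ω) - α ^ 2 * (∑ k ∈ Finset.range n, V k ω) / 2)) ∂P ≤ 1 := by
  induction n with
  | zero => simp
  | succ n ih =>
    -- `M_{n+1} = M_n · E_n` pointwise
    have hsplit : ∀ ω, ENNReal.ofReal (Real.exp
          (α * (f (n + 1) ω - f 0 ω) - α ^ 2 * (∑ k ∈ Finset.range (n + 1), V k ω) / 2))
        = ENNReal.ofReal (Real.exp
            (α * (f n ω - f 0 ω) - α ^ 2 * (∑ k ∈ Finset.range n, V k ω) / 2))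
          * ENNReal.ofReal (Real.exp (α * (f (n + 1) ω - f n ω) - α ^ 2 * V n ω / 2)) := by
      intro ω
      rw [← ENNReal.ofReal_mul (Real.exp_pos _).le, ← Real.exp_add, Finset.sum_range_succ]
      congr 2
      ring
    simp_rw [hsplit]
    -- `M_n` is `ℱ n`-measurable
    have hf0 : Measurable[ℱ n] (f 0) := (hf 0).mono (hmono (Nat.zero_le n)) le_rfl
    have hS : Measurable[ℱ n] fun ω => ∑ k ∈ Finset.range n, V k ω :=
      Finset.measurable_sum (Finset.range n) fun k hk =>
        (hV k).mono (hmono (Finset.mem_range.1 hk).le) le_rfl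
    have hM : Measurable[ℱ n] fun ω => ENNReal.ofReal
        (Real.exp (α * (f n ω - f 0 ω) - α ^ 2 * (∑ k ∈ Finset.range n, V k ω) / 2)) :=
      measurable_stepDensity (hf n) hf0 hS α
    -- the one-step density is measurable w.r.t. the ambient σ-algebra
    have hρ : Measurable fun ω =>
        ENNReal.ofReal (Real.exp (α * (f (n + 1) ω - f n ω) - α ^ 2 * V n ω / 2)) :=
      measurable_stepDensity ((hf (n + 1)).mono (hle (n + 1)) le_rfl)
        ((hf n).mono (hle n) le_rfl) ((hV n).mono (hle n) le_rfl) α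
    exact (lintegral_mul_le_of_setLIntegral_le (hle n) hρ (H n) hM).trans ih

end EntropyLedger

/-- S2 — THE LEDGER: exponential-supermartingale / Donsker–Varadhan transportation inequality `E_Q X − E_Q f_0 ≤ KL(Q‖P)/α + (α/2) E_Q ΣV` (registered stub `stub_entropyLedger` of line `gossip-forecast-ledger`, crux stmt-AtomisticToContinuum-14662). [folklore] -/
theorem stub_entropyLedger :
    ∀ (Ω : Type) [mΩ : MeasurableSpace Ω] (P Q : Measure Ω) [IsProbabilityMeasure P] [IsProbabilityMeasure Q],
      Q ≪ P → klDiv Q P ≠ ∞ →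
      ∀ (ℱ : ℕ → MeasurableSpace Ω), Monotone ℱ → (∀ n, ℱ n ≤ mΩ) →
      ∀ (X : Ω → ℝ), Integrable X P → Integrable X Q → AEStronglyMeasurable[⨆ n, ℱ n] X P →
      Integrable (P[X|ℱ 0]) Q →
      ∀ α : ℝ, 0 < α → ∀ (V : ℕ → Ω → ℝ), (∀ k ω, 0 ≤ V k ω) → (∀ k, Measurable[ℱ k] (V k)) →
      (∀ᵐ ω ∂P, Summable (fun k => V k ω)) → Integrable (fun ω => ∑' k, V k ω) Q →
      (∀ (k : ℕ) (s : Set Ω), MeasurableSet[ℱ k] s →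
        ∫⁻ ω in s, ENNReal.ofReal (Real.exp (α * ((P[X|ℱ (k + 1)]) ω - (P[X|ℱ k]) ω) - α ^ 2 * V k ω / 2)) ∂P
          ≤ P s) →
      ∫ ω, X ω ∂Q - ∫ ω, (P[X|ℱ 0]) ω ∂Q ≤ (klDiv Q P).toReal / α + α / 2 * ∫ ω, (∑' k, V k ω) ∂Q := by
  intro Ω mΩ P Q _ _ hQP hKL ℱ hmono hle X hXP hXQ hXm hf0Q α hα V _hV0 hVm hVsum hVQ hH
  -- the forecasts `f_n := P[X | ℱ n]` are adapted
  have hf : ∀ n, Measurable[ℱ n] (P[X|ℱ n]) := fun n => stronglyMeasurable_condExp.measurable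
  -- (i) exponential supermartingale iteration: `∫⁻ M_n dP ≤ 1`
  have hMn : ∀ n, ∫⁻ ω, ENNReal.ofReal (Real.exp (α * ((P[X|ℱ n]) ω - (P[X|ℱ 0]) ω)
      - α ^ 2 * (∑ k ∈ Finset.range n, V k ω) / 2)) ∂P ≤ 1 :=
    EntropyLedger.lintegral_expMartingale_le_one ℱ hmono hle (fun n => P[X|ℱ n]) V hf hVm α hH
  -- (ii) Lévy's upward theorem: `f_n → X` `P`-a.e.
  have hlim : ∀ᵐ ω ∂P, Tendsto (fun n => (P[X|ℱ n]) ω) atTop (𝓝 (X ω)) := by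
    have h1 : ∀ᵐ ω ∂P, Tendsto (fun n => (P[X|ℱ n]) ω) atTop (𝓝 ((P[X|⨆ n, ℱ n]) ω)) :=
      MeasureTheory.tendsto_ae_condExp (μ := P) (ℱ := ⟨ℱ, hmono, hle⟩) X
    have h2 : P[X|⨆ n, ℱ n] =ᵐ[P] X := condExp_of_aestronglyMeasurable' (iSup_le hle) hXm hXP
    filter_upwards [h1, h2] with ω h1ω h2ω
    rw [h2ω] at h1ω
    exact h1ω
  -- partial sums of `V` converge `P`-a.e.
  have hVlim : ∀ᵐ ω ∂P,
      Tendsto (fun n => ∑ k ∈ Finset.range n, V k ω) atTop (𝓝 (∑' k, V k ω)) := by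
    filter_upwards [hVsum] with ω hω using hω.hasSum.tendsto_sum_nat
  -- hence `M_n → M_∞ := exp (α (X − f_0) − (α²/2) Σ' V)` `P`-a.e.
  have hMlim : ∀ᵐ ω ∂P, Tendsto (fun n => ENNReal.ofReal (Real.exp
      (α * ((P[X|ℱ n]) ω - (P[X|ℱ 0]) ω) - α ^ 2 * (∑ k ∈ Finset.range n, V k ω) / 2))) atTop
      (𝓝 (ENNReal.ofReal (Real.exp
        (α * (X ω - (P[X|ℱ 0]) ω) - α ^ 2 * (∑' k, V k ω) / 2)))) := by
    filter_upwards [hlim, hVlim] with ω h1 h2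
    exact ENNReal.tendsto_ofReal
      (((h1.sub_const _).const_mul α).sub ((h2.const_mul _).div_const 2)).rexp
  -- Fatou: `∫⁻ M_∞ dP ≤ 1`
  have hmeas : ∀ n, Measurable fun ω => ENNReal.ofReal (Real.exp
      (α * ((P[X|ℱ n]) ω - (P[X|ℱ 0]) ω) - α ^ 2 * (∑ k ∈ Finset.range n, V k ω) / 2)) :=
    fun n => EntropyLedger.measurable_stepDensity ((hf n).mono (hle n) le_rfl)
      ((hf 0).mono (hle 0) le_rfl)
      (Finset.measurable_sum _ fun k _ => (hVm k).mono (hle k) le_rfl) α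
  have hFatou : ∫⁻ ω, ENNReal.ofReal
      (Real.exp (α * (X ω - (P[X|ℱ 0]) ω) - α ^ 2 * (∑' k, V k ω) / 2)) ∂P ≤ 1 :=
    calc ∫⁻ ω, ENNReal.ofReal
          (Real.exp (α * (X ω - (P[X|ℱ 0]) ω) - α ^ 2 * (∑' k, V k ω) / 2)) ∂P
        = ∫⁻ ω, liminf (fun n => ENNReal.ofReal (Real.exp (α * ((P[X|ℱ n]) ω - (P[X|ℱ 0]) ω)
            - α ^ 2 * (∑ k ∈ Finset.range n, V k ω) / 2))) atTop ∂P :=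
          lintegral_congr_ae (by filter_upwards [hMlim] with ω hω; exact hω.liminf_eq.symm)
      _ ≤ liminf (fun n => ∫⁻ ω, ENNReal.ofReal (Real.exp (α * ((P[X|ℱ n]) ω - (P[X|ℱ 0]) ω)
            - α ^ 2 * (∑ k ∈ Finset.range n, V k ω) / 2)) ∂P) atTop :=
          lintegral_liminf_le hmeas
      _ ≤ 1 := liminf_le_of_frequently_le' (Eventually.of_forall hMn).frequently
  -- (iii) Donsker–Varadhan with `g := log M_∞`
  have hgm : AEMeasurable
      (fun ω => α * (X ω - (P[X|ℱ 0]) ω) - α ^ 2 * (∑' k, V k ω) / 2) P := by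
    have hX : AEMeasurable X P := hXP.aemeasurable
    have h0 : Measurable (P[X|ℱ 0]) := (hf 0).mono (hle 0) le_rfl
    have hT : AEMeasurable (fun ω => ∑' k, V k ω) P :=
      aemeasurable_of_tendsto_metrizable_ae' (fun n =>
        (Finset.measurable_sum _ fun k _ => (hVm k).mono (hle k) le_rfl).aemeasurable) hVlim
    exact ((hX.sub h0.aemeasurable).const_mul α).sub ((hT.const_mul _).div_const 2)
  have hgQ : Integrable
      (fun ω => α * (X ω - (P[X|ℱ 0]) ω) - α ^ 2 * (∑' k, V k ω) / 2) Q :=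
    ((hXQ.sub hf0Q).const_mul α).sub ((hVQ.const_mul _).div_const 2)
  have hDV :=
    EntropyLedger.integral_le_toReal_klDiv_of_lintegral_exp_le_one hQP hKL hgm hgQ hFatou
  -- evaluate `∫ g dQ` and divide by `α`
  have hI1 : Integrable (fun ω => X ω - (P[X|ℱ 0]) ω) Q := hXQ.sub hf0Q
  have hI2 : Integrable (fun ω => α * (X ω - (P[X|ℱ 0]) ω)) Q := hI1.const_mul α
  have hI3 : Integrable (fun ω => α ^ 2 * (∑' k, V k ω) / 2) Q :=
    (hVQ.const_mul _).div_const 2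
  have hint : ∫ ω, (α * (X ω - (P[X|ℱ 0]) ω) - α ^ 2 * (∑' k, V k ω) / 2) ∂Q
      = α * (∫ ω, X ω ∂Q - ∫ ω, (P[X|ℱ 0]) ω ∂Q) - α ^ 2 * (∫ ω, (∑' k, V k ω) ∂Q) / 2 := by
    rw [integral_sub hI2 hI3, integral_const_mul, integral_sub hXQ hf0Q, integral_div,
      integral_const_mul]
  rw [hint] at hDV
  have hα' : α ≠ 0 := hα.ne'
  have hrew : (klDiv Q P).toReal / α + α / 2 * ∫ ω, (∑' k, V k ω) ∂Q
      = ((klDiv Q P).toReal + α ^ 2 * (∫ ω, (∑' k, V k ω) ∂Q) / 2) / α := by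
    field_simp
  rw [hrew, le_div_iff₀ hα]
  linarith

end Summit.AtomisticToContinuum.HydrodynamicLimit.Theorems.KineticCurrentsWindowLDUniformGossip

end
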